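import Mathlib
import Summits.Ventures.PercRepro2.CoinOrTailKDefs
import Summits.Ventures.PercRepro2.CoinChainTower
import Summits.Ventures.PercRepro2.CoinTowerFunnelCore

/-!
# The funnel at a core vertex: an instantiation with no hypothesis at all
(blind cell PercRepro2, night-2 g18; NIGHT2-DARC.md §58.12)

Ten coins on `Fin 8` (s = 0, m = 1, q = 2, v = 3, a = 4, h = 5, w = 6, t = 7): the core `{m, q}`
(`s → m`, `s → q` — no out-tree or log-supermodularity is used), the tower vertex `v` entered from
`m`, the free-arc vertex `a` entered from `v` and `m` (three random coins), the head `a → t`,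
`v → h → t`, `q → h`, `w → t`.  Every route into `a` passes through `m`: row 2′DARC at `a → w` for
the markers `(m, a)` for EVERY probability vector (`darc_funnelCore_example`).
-/

namespace Summit.Ventures.PercRepro2.Coin

namespace FunnelCoreExample

open Classical

/-- The ten coins of the example. -/
def arcsF : Fin 10 → Finset (Fin 8 × Fin 8)
  | 0 => {(0, 1)}   -- s → m
  | 1 => {(0, 2)}   -- s → q
  | 2 => {(1, 3)}   -- m → v
  | 3 => {(3, 4)}   -- v → a
  | 4 => {(1, 4)}   -- m → a
  | 5 => {(4, 7)}   -- a → t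
  | 6 => {(3, 5)}   -- v → h
  | 7 => {(5, 7)}   -- h → t
  | 8 => {(6, 7)}   -- w → t
  | 9 => {(2, 5)}   -- q → h
  | _ => ∅

/-- The entry coin of `v`. -/
def cvF : Fin 8 → Fin 10
  | 1 => 2
  | _ => 0

/-- The entry coins of `a`. -/
def cF : Fin 8 → Fin 10
  | 3 => 3
  | 1 => 4
  | _ => 0

/-- Every coin is a single arc. -/
lemma sameEnds_f : SameEnds arcsF := by
  intro e xy hxy x'y' hx'y'
  fin_cases e <;> simp [arcsF] at hxy hx'y' <;> subst hxy <;> subst hx'y' <;>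
    exact ⟨Or.inl rfl, Or.inr rfl⟩

set_option maxRecDepth 20000 in
/-- `v = 3` is an OR-vertex of the core `{m, q}` entered from `m`. -/
lemma orTailK_v : OrTailK arcsF 0 {1, 2} {1} cvF 3 where
  ent_sub := by decide
  s_notin := by decide
  a_notin := by decide
  a_ne_s := by decide
  into_U := by decide
  into_s := by decide
  into_a := by decide
  arcs_c := by decide
  c_inj := by decide

set_option maxRecDepth 20000 in
/-- `a = 4` is an OR-vertex of `{m, q, v}` entered from `v` and `m`. -/
lemma orTailK_a : OrTailK arcsF 0 (insert 3 {1, 2}) {3, 1} cF 4 where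
  ent_sub := by decide
  s_notin := by decide
  a_notin := by decide
  a_ne_s := by decide
  into_U := by decide
  into_s := by decide
  into_a := by decide
  arcs_c := by decide
  c_inj := by decide

/-- The one-vertex tower `[v]` over the core. -/
lemma orTower_f : OrTower arcsF 0 {1, 2} [({1}, cvF, 3)] :=
  OrTower.cons _ _ _ _ _ orTailK_v (OrTower.nil _)

/-- **Row 2′DARC at `a → w` for the markers `(m, a)` on the ten-coin instance, every probability
vector — no hypothesis, no log-supermodularity.** -/
theorem darc_funnelCore_example {R : Type*} [Field R] [LinearOrder R] [IsStrictOrderedRing R]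
    (pr : Fin 10 → R) (hp : IsProbVec pr) : DARC pr arcsF 0 {7} 1 4 4 6 :=
  darc_of_funnelCore pr hp sameEnds_f orTower_f orTailK_a (by decide)
    (by
      intro x hx
      simp only [List.mem_cons, List.not_mem_nil, or_false] at hx
      subst hx; decide)
    (by decide) (by decide) (by decide) (by decide) (by decide)

end FunnelCoreExample

end Summit.Ventures.PercRepro2.Coin
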